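import Summits.CriticalPhenomena.PercolationContinuityZ3.Theorems.PercNearOneGluingNoHeavyQuantTreeBuiltAD3Cells
import Summits.CriticalPhenomena.PercolationContinuityZ3.Theorems.PercNearOneGluingNoHeavyQuantSGCLightPairPairTools
import Summits.CriticalPhenomena.PercolationContinuityZ3.Theorems.PercNearOneGluingNoHeavyQuantFlowPieces
import Summits.CriticalPhenomena.PercolationContinuityZ3.Theorems.PercNearOneGluingNoHeavyQuantLawDecFlowsDecomposition
import HarnessLib

/-!
# QUANT lane R8, T-DEC, leg (III): ADMISSIBLE LIGHT PAIRS ARE EXACTLY THE TOP-AFFORDABLE LIGHT PAIRS WITH A SELF-SUFFICIENT LOW ATOM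
# (`q·T ≤ 2·lo`) — the converse of typer g31's `lightPair_two_lo_ge` by the moment criterion; hence every top-affordable pair with
# `q·T ≤ 2·lo` is an AD3⁺ component for free (Route 2's L2 components carry no DEC obligation)

builds on p205010 (kernel theorem, internal audit signed; external expert review pending)

Support file (`--supports stmt-CriticalPhenomena-4575`), QUANT lane, seat prim-quant-arm-3 (gen 121), rung R8 of
`run/shared/lean/prim/quant/LADDER.md`.  Theorems only, standard axioms, no sorries, no definitions.

* **`LawDec.gate_TP_decAt_of_two_lo_ge`** — a gated pair `gate_q{lo, hi; γ}` (`lo < hi ≤ M`, `0 ≤ γ ≤ 1`, `0 < q ≤ 1`, floor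
  `0 < y < 1`) which is top-affordable (`y·M ≤ q·T`, `T = lo + (hi−lo)γ`) and has `q·T ≤ 2·lo` is DEC at EVERY layer `j′` — heavy or
  light: its only low atom is the gate zero (moment criterion `flowAtT_of_moment`, lead g30).
* **`LawDec.lightPair_admissible_iff`** — for a top-affordable LIGHT pair (`q·γ < y`): (`gate_q{lo,hi;γ}` DEC at every layer `j′ < M`)
  `↔ q·T ≤ 2·lo` (⟹ is `lightPair_two_lo_ge`).  So the hypothesis block "admissible light pair" of the cells L2 / PP / PT and of
  `AD3Decomp` is the explicit inequality `q·T ≤ 2·lo`.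
* **`LawDec.isAD3Component_pair_of_two_lo_ge`** — every top-affordable pair `lo < hi ≤ M` of mean `T` with `q·T ≤ 2·lo` is an AD3⁺
  component at `(y, q, T, M)` (H if `y ≤ qγ`, else L2 with its DEC obligation discharged).  For Route 2 (`AD3ProdCell`, `AD3GateCell`,
  typer g31) this means: pair components cost nothing unless their low atom is a genuine low (`2·lo < q·T`), in which case they must be
  heavy — the decomposition cells are pure transport problems "low atoms ↦ heavy partners".
HONEST STATUS: `AD3ProdCell`, `AD3GateCell`, `TreeBuiltAD3`, the light cells' residuals, CW, `SingleGateConvClosed`, `FarTreeRow` remain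
OPEN; nothing here is a published result; RATE class log\* / honest sentence unchanged.

[this work]; `lightPair_two_lo_ge`: prim-quant-stmt g31; moment criterion: prim-quant-lead g30; AD3⁺ components: prim-quant-stmt g31 (this
lane).  The gluing rows served [cite: KozmaNitzan2024, Conjecture 3 (p. 15)]; product measure [cite: Grimmett1999, §1.3 p. 10].
-/

noncomputable section

namespace Summit.CriticalPhenomena.PercolationContinuityZ3.Theorems

namespace Quant

open Finset

/-- two-point law notation `TP[lo, hi, g, h] = g·[h = hi] + (1 − g)·[h = lo]` (as in the lane's other files). -/
local notation3 "TP[" lo ", " hi ", " g ", " h "]" =>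
  (g : ℝ) * (if (h : ℕ) = (hi : ℕ) then (1 : ℝ) else 0) + (1 - (g : ℝ)) * (if (h : ℕ) = (lo : ℕ) then (1 : ℝ) else 0)

namespace LawDec

/-- **A TOP-AFFORDABLE GATED PAIR WITH A SELF-SUFFICIENT LOW ATOM IS DEC AT EVERY LAYER** (heavy or light). [this work] -/
theorem gate_TP_decAt_of_two_lo_ge (y q γ : ℝ) (M lo hi j' : ℕ) (hy0 : 0 < y) (hy1 : y < 1) (hq0 : 0 < q) (hq1 : q ≤ 1)
    (hlohi : lo < hi) (hhi : hi ≤ M) (hγ0 : 0 ≤ γ) (hγ1 : γ ≤ 1)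
    (hta : y * (M : ℝ) ≤ q * ((lo : ℝ) + ((hi : ℝ) - lo) * γ)) (h2lo : q * ((lo : ℝ) + ((hi : ℝ) - lo) * γ) ≤ 2 * (lo : ℝ)) :
    DECAt y j' M (gate (fun h => TP[lo, hi, γ, h]) q) := by
  obtain ⟨a0, aM, a1, amean⟩ := tp_laws M lo hi γ hγ0 hγ1 hlohi.le hhi
  obtain ⟨n0, nM, n1⟩ := gate_laws M (fun h => TP[lo, hi, γ, h]) q hq0.le hq1 a0 aM a1
  have nmean : ∑ h ∈ Finset.range (M + 1), (h : ℝ) * gate (fun h => TP[lo, hi, γ, h]) q h =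
      q * ((lo : ℝ) + ((hi : ℝ) - lo) * γ) := by
    rw [sum_mul_gate, amean]
  have hM : (1 : ℝ) ≤ M := by exact_mod_cast (show 1 ≤ M by omega)
  have htpos : 0 < q * ((lo : ℝ) + ((hi : ℝ) - lo) * γ) := lt_of_lt_of_le (by nlinarith) hta
  have hlohi' : (lo : ℝ) < hi := by exact_mod_cast hlohi
  rw [decAt_iff_decAtT, nmean]
  refine decAtT_of_flowAtT y _ j' M _ hy0 hy1 nM n1 ?_
  refine flowAtT_of_moment y _ j' M _ hy0 hy1 htpos n0 ?_ hta (by rw [n1, nmean, mul_one])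
  intro l hl1 _ hlow
  have hlo' : l ≠ lo := by
    rintro rfl; linarith
  have hhi' : l ≠ hi := by
    rintro rfl; linarith
  rw [gate_apply, if_neg (show l ≠ 0 by omega), if_neg hhi', if_neg hlo']
  ring

/-- **ADMISSIBLE LIGHT PAIRS = TOP-AFFORDABLE LIGHT PAIRS WITH `q·T ≤ 2·lo`.**  (⟹ typer g31's `lightPair_two_lo_ge`; ⟸ the moment
criterion.) [this work] -/
theorem lightPair_admissible_iff (y q γ : ℝ) (M lo hi : ℕ) (hy0 : 0 < y) (hy1 : y < 1) (hq0 : 0 < q) (hq1 : q ≤ 1)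
    (hlohi : lo < hi) (hhi : hi ≤ M) (hγ0 : 0 ≤ γ) (hγ1 : γ ≤ 1) (hlight : q * γ < y)
    (hta : y * (M : ℝ) ≤ q * ((lo : ℝ) + ((hi : ℝ) - lo) * γ)) :
    (∀ j', j' < M → DECAt y j' M (gate (fun h => TP[lo, hi, γ, h]) q)) ↔
      q * ((lo : ℝ) + ((hi : ℝ) - lo) * γ) ≤ 2 * (lo : ℝ) :=
  ⟨fun hD => lightPair_two_lo_ge y q γ M lo hi hy1.le hlohi hhi hγ0 hγ1 hlight hD,
    fun h2lo j' _ => gate_TP_decAt_of_two_lo_ge y q γ M lo hi j' hy0 hy1 hq0 hq1 hlohi hhi hγ0 hγ1 hta h2lo⟩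

/-- **EVERY TOP-AFFORDABLE PAIR WITH `q·T ≤ 2·lo` IS AN AD3⁺ COMPONENT** (heavy ⟹ H; light ⟹ L2 with its DEC obligation discharged by
`gate_TP_decAt_of_two_lo_ge`). [this work] -/
theorem isAD3Component_pair_of_two_lo_ge (y q γ : ℝ) (M lo hi : ℕ) (hy0 : 0 < y) (hy1 : y < 1) (hq0 : 0 < q) (hq1 : q ≤ 1)
    (hlohi : lo < hi) (hhi : hi ≤ M) (hγ0 : 0 ≤ γ) (hγ1 : γ ≤ 1)
    (hta : y * (M : ℝ) ≤ q * ((lo : ℝ) + ((hi : ℝ) - lo) * γ)) (h2lo : q * ((lo : ℝ) + ((hi : ℝ) - lo) * γ) ≤ 2 * (lo : ℝ)) :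
    IsAD3Component y q ((lo : ℝ) + ((hi : ℝ) - lo) * γ) M (fun h => TP[lo, hi, γ, h]) := by
  by_cases hheavy : y ≤ q * γ
  · exact Or.inl ⟨lo, hi, γ, hlohi.le, hhi, hγ0, hγ1, hheavy, rfl, rfl⟩
  · exact Or.inr (Or.inl ⟨lo, hi, γ, hlohi, hhi, hγ0, hγ1, not_le.1 hheavy, rfl,
      fun j' _ => gate_TP_decAt_of_two_lo_ge y q γ M lo hi j' hy0 hy1 hq0 hq1 hlohi hhi hγ0 hγ1 hta h2lo, rfl⟩)

end LawDec

end Quant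

end Summit.CriticalPhenomena.PercolationContinuityZ3.Theorems
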